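import Summits.BirchSwinnertonDyer.BirchSwinnertonDyer.Theorems.ManinLocalTwoThreeKatoShiftHoleOrthogonality

/-!
# Route `ManinLocalTwoThree`, crux C2 `ManinOddAtFour` (stmt-BirchSwinnertonDyer-22967), line `kato-shift-two`
# (es g7), stub `stub_two_dvd_multiShiftClass`: EVEN orthogonality, the MULTI-SHIFT transform
# `ŷ(χ) = ∏_{t∈G}(1 − χ(t⁻¹))·A_x(χ)` (holes at every `t ∈ G`), and the evenness of the multi-shift coordinates
# from `2`-integrality of `A_x(χ)/4` off the holes — pure character-sum arithmetic (line prover p1; helper)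

The `p = 2` twin of `…KatoShiftHoleOrthogonality` (there: ONE hole at `⟨3⟩`, odd characters, imaginary side).
At `p = 2` the Euler factors at EVERY `q ∥ N` have an unavoidable hole (`q − a_q χ(q)` is even when `χ(q) = 1`)
and the receptacle needs `χ(8) ≠ 1`; the line kills all holes at once with the MULTI-SHIFT coordinates
`y(u) = Σ_{T ⊆ G} (−1)^{|T|} x(u·∏_{t∈T} t)` (`G = {8} ∪ {q ∥ N}` as units mod `ℓ`), whose transform is
`ŷ(χ) = ∏_{t∈G}(1 − χ(t)⁻¹)·A_x(χ)` — zero whenever `χ` sits in a hole — and works on the PLUS side with EVEN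
characters (all of odd order when `ℓ ≡ 3 (mod 4)`). Proved here for any prime modulus `ℓ`, any finite set of
units `G`, any weight `x`:
* `two_mul_sum_even_char_weighted` — `2 Σ_{χ even} χ(b⁻¹) A_y(χ) = φ(ℓ)(y(b) + y(−b))`;
* `sum_char_mul_shift` — `Σ_v χ(v) x(v·t) = χ(t⁻¹)·A_x(χ)` for a unit `t`;
* `charSum_multiShift` — the multi-shift transform above (`Finset.prod_one_add`);
* `prod_one_sub_eq_zero_of_hole` — `∏_{t∈G}(1 − χ(t⁻¹)) = 0` if `χ(t) = 1` for some `t ∈ G`;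
* `two_dvd_multiShift_of_pint` — **the punch**: `x` even and integer-valued, `ℓ ≡ 3 (mod 4)`, and
  `A_x(χ)/4` `2`-integral for every EVEN `χ` with `χ(t) ≠ 1` for all `t ∈ G` ⟹ `2 ∣ y(u)` for every unit `u`.
In the line: `x(a) = Re{0,a/ℓ}_f/(Ω⁺_f/2)`, and `A_x(χ)/4` is `2`-integral by the `p = 2` Kato fact F-es-21 at a
lattice-optimal datum with `2 ∣ c` (and `Δ < 0 ∨ 4 ∣ c`). Nothing about BSD or Manin's conjecture is proved here.
-/

set_option autoImplicit false
set_option linter.dupNamespace false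

noncomputable section

open scoped Classical

open Summit.BirchSwinnertonDyer.BirchSwinnertonDyer.Theorems.ManinFrameResidueProperRTameTwist

namespace Summit.BirchSwinnertonDyer.BirchSwinnertonDyer.Theorems.ManinLocalTwoThree

section Even

variable {ℓ : ℕ} [NeZero ℓ]

/-- **Orthogonality over the EVEN Dirichlet characters modulo `ℓ`**: for a unit `b` and any `a`,
`2 · Σ_{χ even} χ(b⁻¹) χ(a) = φ(ℓ) 𝟙_{a = b} + φ(ℓ) 𝟙_{a = −b}` (`2·𝟙_even(χ) = 1 + χ(−1)`). [folklore] -/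
theorem two_mul_sum_even_char_inv_mul_char (b : ZMod ℓ) (hb : IsUnit b) (a : ZMod ℓ) :
    2 * ∑ χ ∈ (Finset.univ : Finset (DirichletCharacter ℂ ℓ)) with χ.Even, χ b⁻¹ * χ a =
      (if b = a then (ℓ.totient : ℂ) else 0) + (if b = -a then (ℓ.totient : ℂ) else 0) := by
  have hind : ∀ χ : DirichletCharacter ℂ ℓ,
      (2 : ℂ) * (if χ.Even then χ b⁻¹ * χ a else 0) = χ b⁻¹ * χ a + χ b⁻¹ * χ (-a) := by
    intro χ
    rcases χ.even_or_odd with h | h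
    · rw [if_pos h, h.eval_neg]; ring
    · rw [if_neg h.not_even, h.eval_neg]; ring
  rw [Finset.sum_filter, Finset.mul_sum]
  simp_rw [hind]
  rw [Finset.sum_add_distrib, DirichletCharacter.sum_char_inv_mul_char_eq ℂ hb a,
    DirichletCharacter.sum_char_inv_mul_char_eq ℂ hb (-a)]

/-- **Even orthogonality against a weight**: `2 Σ_{χ even} χ(b⁻¹) A_y(χ) = φ(ℓ)·(y(b) + y(−b))`.
[folklore] -/
theorem two_mul_sum_even_char_weighted (y : ZMod ℓ → ℂ) (b : ZMod ℓ) (hb : IsUnit b) :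
    2 * ∑ χ ∈ (Finset.univ : Finset (DirichletCharacter ℂ ℓ)) with χ.Even,
        χ b⁻¹ * (∑ a : ZMod ℓ, χ a * y a) = (ℓ.totient : ℂ) * (y b + y (-b)) := by
  have hswap : ∑ χ ∈ (Finset.univ : Finset (DirichletCharacter ℂ ℓ)) with χ.Even,
      χ b⁻¹ * (∑ a : ZMod ℓ, χ a * y a) =
      ∑ a : ZMod ℓ, (∑ χ ∈ (Finset.univ : Finset (DirichletCharacter ℂ ℓ)) with χ.Even,
        χ b⁻¹ * χ a) * y a := by
    simp only [Finset.mul_sum, Finset.sum_mul, mul_assoc]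
    exact Finset.sum_comm
  rw [hswap, Finset.mul_sum]
  simp_rw [← mul_assoc, two_mul_sum_even_char_inv_mul_char b hb, add_mul, Finset.sum_add_distrib,
    ite_mul, zero_mul, Finset.sum_ite_eq, Finset.mem_univ, if_true]
  have hneg : ∑ a : ZMod ℓ, (if b = -a then (ℓ.totient : ℂ) * y a else 0) =
      (ℓ.totient : ℂ) * y (-b) := by
    have : ∀ a : ZMod ℓ, (b = -a) = (-b = a) := by
      intro a; rw [neg_eq_iff_eq_neg]
    simp_rw [this, Finset.sum_ite_eq, Finset.mem_univ, if_true]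
  rw [hneg]
  ring

/-- **Shifting the weight by a unit multiplies the transform by `χ(t⁻¹)`**:
`Σ_v χ(v) x(v·t) = χ(t⁻¹) Σ_w χ(w) x(w)`. [folklore] -/
theorem sum_char_mul_shift (x : ZMod ℓ → ℂ) (χ : DirichletCharacter ℂ ℓ) (t : (ZMod ℓ)ˣ) :
    ∑ v : ZMod ℓ, χ v * x (v * t) = χ ((t⁻¹ : (ZMod ℓ)ˣ) : ZMod ℓ) * ∑ w : ZMod ℓ, χ w * x w := by
  rw [Finset.mul_sum, ← Equiv.sum_comp (Units.mulRight t⁻¹) (fun v ↦ χ v * x (v * (t : ZMod ℓ)))]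
  refine Finset.sum_congr rfl fun w _ ↦ ?_
  change χ (w * ((t⁻¹ : (ZMod ℓ)ˣ) : ZMod ℓ)) * x (w * ((t⁻¹ : (ZMod ℓ)ˣ) : ZMod ℓ) * (t : ZMod ℓ)) = _
  rw [mul_assoc w, ← Units.val_mul, inv_mul_cancel, Units.val_one, mul_one, map_mul]
  ring

/-- **The multi-shift transform**: for a finite set `G` of units and
`y(v) = Σ_{T ⊆ G} (−1)^{|T|} x(v·∏_{t∈T} t)`,
`Σ_v χ(v) y(v) = (∏_{t∈G} (1 − χ(t⁻¹))) · Σ_w χ(w) x(w)`. [folklore] -/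
theorem charSum_multiShift (x : ZMod ℓ → ℂ) (χ : DirichletCharacter ℂ ℓ) (G : Finset (ZMod ℓ)ˣ) :
    ∑ v : ZMod ℓ, χ v * (∑ T ∈ G.powerset, (-1 : ℂ) ^ T.card * x (v * ((∏ t ∈ T, t : (ZMod ℓ)ˣ) : ZMod ℓ))) =
      (∏ t ∈ G, (1 - χ ((t⁻¹ : (ZMod ℓ)ˣ) : ZMod ℓ))) * ∑ w : ZMod ℓ, χ w * x w := by
  -- swap the sums and shift each term
  have h1 : ∑ v : ZMod ℓ, χ v * (∑ T ∈ G.powerset, (-1 : ℂ) ^ T.card *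
        x (v * ((∏ t ∈ T, t : (ZMod ℓ)ˣ) : ZMod ℓ))) =
      ∑ T ∈ G.powerset, (-1 : ℂ) ^ T.card *
        (χ (((∏ t ∈ T, t)⁻¹ : (ZMod ℓ)ˣ) : ZMod ℓ) * ∑ w : ZMod ℓ, χ w * x w) := by
    simp only [Finset.mul_sum]
    rw [Finset.sum_comm]
    refine Finset.sum_congr rfl fun T _ ↦ ?_
    have hs := sum_char_mul_shift x χ (∏ t ∈ T, t)
    calc ∑ v : ZMod ℓ, χ v * ((-1 : ℂ) ^ T.card * x (v * ((∏ t ∈ T, t : (ZMod ℓ)ˣ) : ZMod ℓ)))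
        = (-1 : ℂ) ^ T.card * ∑ v : ZMod ℓ, χ v * x (v * ((∏ t ∈ T, t : (ZMod ℓ)ˣ) : ZMod ℓ)) := by
          rw [Finset.mul_sum]; exact Finset.sum_congr rfl fun v _ ↦ by ring
      _ = ∑ i : ZMod ℓ, (-1 : ℂ) ^ T.card *
            (χ (((∏ t ∈ T, t)⁻¹ : (ZMod ℓ)ˣ) : ZMod ℓ) * (χ i * x i)) := by
          rw [hs, Finset.mul_sum, Finset.mul_sum]
  rw [h1]
  -- `χ((∏ t)⁻¹) = ∏ χ(t⁻¹)` and `(−1)^{|T|} ∏ = ∏ (−χ(t⁻¹))`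
  have h2 : ∀ T ∈ G.powerset, (-1 : ℂ) ^ T.card *
      (χ (((∏ t ∈ T, t)⁻¹ : (ZMod ℓ)ˣ) : ZMod ℓ) * ∑ w : ZMod ℓ, χ w * x w) =
      (∏ t ∈ T, (-χ ((t⁻¹ : (ZMod ℓ)ˣ) : ZMod ℓ))) * ∑ w : ZMod ℓ, χ w * x w := by
    intro T _
    have hprod : χ (((∏ t ∈ T, t)⁻¹ : (ZMod ℓ)ˣ) : ZMod ℓ) =
        ∏ t ∈ T, χ ((t⁻¹ : (ZMod ℓ)ˣ) : ZMod ℓ) := by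
      rw [← Finset.prod_inv_distrib, Units.coe_prod, map_prod]
    rw [hprod, Finset.prod_neg, ← mul_assoc]
  rw [Finset.sum_congr rfl h2, ← Finset.sum_mul, ← Finset.prod_one_add]
  refine congrArg (· * _) (Finset.prod_congr rfl fun t _ ↦ by ring)

omit [NeZero ℓ] in
/-- **A hole kills the transform**: if `χ(t) = 1` for some `t ∈ G` then `∏_{t∈G}(1 − χ(t⁻¹)) = 0`. [folklore] -/
theorem prod_one_sub_eq_zero_of_hole (χ : DirichletCharacter ℂ ℓ) (G : Finset (ZMod ℓ)ˣ)
    {t : (ZMod ℓ)ˣ} (ht : t ∈ G) (h1 : χ (t : ZMod ℓ) = 1) :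
    ∏ t ∈ G, (1 - χ ((t⁻¹ : (ZMod ℓ)ˣ) : ZMod ℓ)) = 0 := by
  refine Finset.prod_eq_zero ht ?_
  rw [(apply_inv_eq_one_iff t χ).mpr h1, sub_self]

end Even

/-! ### The punch: evenness of the multi-shift coordinates -/

section Punch

variable {ℓ : ℕ} [hℓ : Fact ℓ.Prime]

/-- **`2 ∣ y(u)` for the multi-shift coordinates.** Let `ℓ ≡ 3 (mod 4)` be prime, `x : ℤ/ℓ → ℤ` EVEN, `G` a
finite set of units mod `ℓ`, and suppose that for every EVEN character `χ` mod `ℓ` with `χ(t) ≠ 1` for all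
`t ∈ G` the number `(Σ_w χ(w) x(w))/4` is `2`-integral. Then every multi-shift coordinate
`y(u) = Σ_{T ⊆ G} (−1)^{|T|} x(u·∏_{t∈T} t)` (`u` a unit) is EVEN: the transform `ŷ(χ)/4` is `2`-integral for
every even `χ` (zero in the holes), `Σ_{χ even} χ(u⁻¹) ŷ(χ) = (ℓ − 1)·y(u)` (even orthogonality, `y` even), and
`(ℓ − 1)/2` is odd. [folklore] -/
theorem two_dvd_multiShift_of_pint (h4 : ℓ % 4 = 3) (x : ZMod ℓ → ℤ) (heven : ∀ a, x (-a) = x a)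
    (G : Finset (ZMod ℓ)ˣ)
    (hA : ∀ χ : DirichletCharacter ℂ ℓ, χ.Even → (∀ t ∈ G, χ (t : ZMod ℓ) ≠ 1) →
      ∃ s : ℕ, ¬ 2 ∣ s ∧ IsIntegral ℤ ((s : ℂ) * ((∑ w : ZMod ℓ, χ w * (x w : ℂ)) / 4)))
    (u : (ZMod ℓ)ˣ) :
    (2 : ℤ) ∣ ∑ T ∈ G.powerset, (-1 : ℤ) ^ T.card * x ((u : ZMod ℓ) * ((∏ t ∈ T, t : (ZMod ℓ)ˣ) : ZMod ℓ)) := by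
  haveI : NeZero ℓ := ⟨hℓ.out.ne_zero⟩
  set y : ZMod ℓ → ℤ := fun v ↦
    ∑ T ∈ G.powerset, (-1 : ℤ) ^ T.card * x (v * ((∏ t ∈ T, t : (ZMod ℓ)ˣ) : ZMod ℓ)) with hydef
  -- `y` is even
  have hyeven : ∀ v, y (-v) = y v := by
    intro v
    simp only [hydef]
    refine Finset.sum_congr rfl fun T _ ↦ ?_
    rw [neg_mul, heven]
  -- the complexified weight and its transform
  set yc : ZMod ℓ → ℂ := fun v ↦ (y v : ℂ) with hyc
  have hyc_eq : ∀ v, yc v = ∑ T ∈ G.powerset, (-1 : ℂ) ^ T.card *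
      (fun w : ZMod ℓ ↦ (x w : ℂ)) (v * ((∏ t ∈ T, t : (ZMod ℓ)ˣ) : ZMod ℓ)) := by
    intro v; simp only [hyc, hydef]; push_cast; rfl
  have htrans : ∀ χ : DirichletCharacter ℂ ℓ,
      ∑ v : ZMod ℓ, χ v * yc v =
        (∏ t ∈ G, (1 - χ ((t⁻¹ : (ZMod ℓ)ˣ) : ZMod ℓ))) * ∑ w : ZMod ℓ, χ w * (x w : ℂ) := by
    intro χ
    simp_rw [hyc_eq]
    exact charSum_multiShift (fun w ↦ (x w : ℂ)) χ G
  -- each `ŷ(χ)/4` is `2`-integral for even `χ`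
  have hpint : ∀ χ : DirichletCharacter ℂ ℓ, χ.Even →
      ∃ s : ℕ, ¬ 2 ∣ s ∧ IsIntegral ℤ ((s : ℂ) * (χ (u : ZMod ℓ)⁻¹ * ((∑ v : ZMod ℓ, χ v * yc v) / 4))) := by
    intro χ hχ
    refine pint_mul Nat.prime_two (pint_of_isIntegral Nat.prime_two
      (isIntegral_dirichletCharacter_apply χ _)) ?_
    rw [htrans χ, mul_div_assoc]
    by_cases hhole : ∃ t ∈ G, χ (t : ZMod ℓ) = 1
    · obtain ⟨t, ht, h1⟩ := hhole
      rw [prod_one_sub_eq_zero_of_hole χ G ht h1, zero_mul]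
      exact pint_of_isIntegral Nat.prime_two isIntegral_zero
    · push Not at hhole
      refine pint_mul Nat.prime_two (pint_of_isIntegral Nat.prime_two ?_) (hA χ hχ hhole)
      refine IsIntegral.prod _ fun t _ ↦ ?_
      exact isIntegral_one.sub (isIntegral_dirichletCharacter_apply χ _)
  have hsum : ∃ s : ℕ, ¬ 2 ∣ s ∧ IsIntegral ℤ ((s : ℂ) *
      ∑ χ ∈ (Finset.univ : Finset (DirichletCharacter ℂ ℓ)) with χ.Even,
        χ (u : ZMod ℓ)⁻¹ * ((∑ v : ZMod ℓ, χ v * yc v) / 4)) :=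
    pint_sum Nat.prime_two _ _ fun χ hχ ↦ hpint χ (Finset.mem_filter.mp hχ).2
  -- even orthogonality: the sum is `(ℓ − 1)·y(u)/4`
  have horth := two_mul_sum_even_char_weighted yc (u : ZMod ℓ) (Units.isUnit u)
  have hycu : yc (-(u : ZMod ℓ)) = yc u := by simp only [hyc, hyeven]
  rw [hycu] at horth
  have horth' : ∑ χ ∈ (Finset.univ : Finset (DirichletCharacter ℂ ℓ)) with χ.Even,
      χ (u : ZMod ℓ)⁻¹ * (∑ v : ZMod ℓ, χ v * yc v) = (ℓ.totient : ℂ) * yc u := by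
    have h2 : (2 : ℂ) ≠ 0 := two_ne_zero
    apply mul_left_cancel₀ h2
    rw [horth]; ring
  have hsum_eq : ∑ χ ∈ (Finset.univ : Finset (DirichletCharacter ℂ ℓ)) with χ.Even,
      χ (u : ZMod ℓ)⁻¹ * ((∑ v : ZMod ℓ, χ v * yc v) / 4) =
      (((((ℓ.totient : ℤ)) * y u : ℤ) : ℚ) / 4 : ℚ) := by
    have h2 : ∑ χ ∈ (Finset.univ : Finset (DirichletCharacter ℂ ℓ)) with χ.Even,
        χ (u : ZMod ℓ)⁻¹ * ((∑ v : ZMod ℓ, χ v * yc v) / 4) =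
        (∑ χ ∈ (Finset.univ : Finset (DirichletCharacter ℂ ℓ)) with χ.Even,
          χ (u : ZMod ℓ)⁻¹ * (∑ v : ZMod ℓ, χ v * yc v)) / 4 := by
      rw [Finset.sum_div]
      exact Finset.sum_congr rfl fun _ _ ↦ by ring
    rw [h2, horth', hyc]
    push_cast
    ring
  rw [hsum_eq] at hsum
  have hval := padicValRat_nonneg_of_pint (p := 2) hsum
  -- `0 ≤ ord₂ (φ(ℓ)·y(u)/4)`, `ord₂ φ(ℓ) = 1` ⟹ `2 ∣ y(u)`
  have hφ : (ℓ.totient : ℤ) = 2 * ((ℓ / 2 : ℕ) : ℤ) := by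
    rw [Nat.totient_prime hℓ.out]
    have : ℓ - 1 = 2 * (ℓ / 2) := by omega
    rw [this]; push_cast; ring
  have hodd : ¬ (2 : ℤ) ∣ ((ℓ / 2 : ℕ) : ℤ) := by
    intro h
    have : 2 ∣ ℓ / 2 := by exact_mod_cast h
    omega
  show (2 : ℤ) ∣ y u
  by_contra hyu
  set K : ℤ := (ℓ.totient : ℤ) * y u with hK
  have hK2 : ¬ (4 : ℤ) ∣ K := by
    intro h4
    rw [hK, hφ, mul_assoc, show (4 : ℤ) = 2 * 2 by norm_num] at h4
    have h2 : (2 : ℤ) ∣ ((ℓ / 2 : ℕ) : ℤ) * y u := (mul_dvd_mul_iff_left two_ne_zero).mp h4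
    rcases Int.Prime.dvd_mul' Nat.prime_two h2 with h | h
    · exact hodd h
    · exact hyu h
  have hK0 : K ≠ 0 := by
    rintro h; exact hK2 (h ▸ dvd_zero 4)
  have h4v : padicValRat 2 (4 : ℚ) = 2 := by
    have : (4 : ℚ) = (2 : ℚ) ^ (2 : ℕ) := by norm_num
    rw [this, padicValRat.pow (p := 2) (2 : ℚ)]
    have h22 : padicValRat 2 (2 : ℚ) = 1 := by exact_mod_cast padicValRat.self (p := 2) one_lt_two
    rw [h22]; norm_num
  have hv : padicValRat 2 (((K : ℤ) : ℚ) / 4) < 0 := by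
    rw [padicValRat.div (by exact_mod_cast hK0) (by norm_num), padicValRat.of_int, h4v]
    have : padicValInt 2 K < 2 := by
      by_contra hge
      push Not at hge
      exact hK2 (by simpa using ((padicValInt_dvd_iff 2 K).mpr (Or.inr hge)))
    have : (padicValInt 2 K : ℤ) < 2 := by exact_mod_cast this
    have : ((padicValInt 2 K : ℤ) : ℚ) < 2 := by exact_mod_cast this
    linarith
  exact absurd hval (not_le.mpr hv)

end Punch


end Summit.BirchSwinnertonDyer.BirchSwinnertonDyer.Theorems.ManinLocalTwoThree

end
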